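import Summits.BirchSwinnertonDyer.BirchSwinnertonDyer.Theorems.ErratumRoadFiveEulerHalfGenusSwapDictionary
import Summits.BirchSwinnertonDyer.BirchSwinnertonDyer.Theorems.ErratumRoadFiveEulerHalfGenusFamilyH47OrdersGuard
import Summits.BirchSwinnertonDyer.BirchSwinnertonDyer.Theorems.ClassRecordThreeCornerAtThreeShimuraSwapSupplyOfPoitouTateGeneric
import Summits.BirchSwinnertonDyer.BirchSwinnertonDyer.Theorems.ClassRecordThreeCornerAtThreeShimuraSwapFamilyCebotarev
import Summits.BirchSwinnertonDyer.BirchSwinnertonDyer.Theorems.PoitouTateSelmerStructureDualityConjHolds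
import HarnessLib

/-!
# ErratumRoadFive ∕ EulerHalf ∕ genus line — toward (b1): KOLYVAGIN'S PRIME SWAP (McCallum Prop. 5.2) FOR THE GENUS LABELLED FAMILY,
# `ShimuraWalk.SwapSupplyAt … ys`, from cell CR3's frame-generic engine (helper, `--supports 23444`)

Cell bsd-stepL, prover seat `bsd-stepL-imc-p1` g42; plan `HOME/imc-p1/g42/B2BK-ASSEMBLY-PLAN-imc-p1-g42.md` §9.

WHAT.  `genusSwapSupplyAt_of_frameProfile` — on a served genus frame with its labelled family `ys` (`LabelsAt W (2N_W) …` + the `±`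
identification `hid`, i.e. `GenusLine.GenusLabelsSupplyOddAt`, p729065) and a parametrisation datum `DtW`:
`ShimuraWalk.SwapSupplyAt hK S.ιc W N_W p ys` (McCallum 1991 Prop. 5.2 = Kolyvagin's prime swap, in cell CR3's universal-divisibility
currency).  It is corner-p1's frame-GENERIC (P1) layer `JET.Swap.shimuraWalk_swapSupplyAt_of_family` (labelled family on `W/K`, `K`
imaginary quadratic, `d_K ∉ {−3, −4}`, `p` odd) with its dictionary DISCHARGED on the genus frame: hbot ∕ hA ∕ hP ∕ hsign ∕ hSel = the
per-datum producers of `…GenusSwapDictionary` (p734084); hceb = `Koly.hceb_family_of_surj` (ρ̄ onto, unconditional); hsel (root classes)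
= `Koly.familyRootKummer_of_selmerLocalKer` + `ShimuraWalk.rootClass_familyData_mem_transverseKer` exactly as in corner3-p2's
`swapSupplyAt_of_poitouTate_of_hceb`; h44 = the H47 producer at the label guard `2N_W` (p729517); hPT = the tree's PROVED
`InputsPoitouTateSelmer.poitouTate_selmerStructure_duality_conj_holds`.  With adapter A (p730113: the genus `mdiv` IS `ShimuraWalk.mdiv` of `ys`)
this is McCallum 5.2 for the genus family; the child (b1) `GenusLine.GenusMcCallum52` is its McCallum-(M_r)-shaped reading (currency decision
pending with the line owner — plan §9).

HONEST FRAMING: conditional on the printed fact (G1) (through `hid`'s provenance) and on `DtW`; no crux and no stub is closed; BSD is proved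
for no curve. [cite: McCallumLMS1991, §5 Prop. 5.2, §4 Prop. 4.4] [cite: GrossLMS1991, §3 (3.2), Prop. 5.4, Prop. 6.2 (1)]
[cite: Jetchev2008, §3.1.2, §3.4.1, Lemma 5.1] [cite: Howard2004HeegnerKolyvagin, Lemma 2.7.3] presearch: in-tree only; no new literature.
-/

set_option autoImplicit false
-- D-0017: single-problem summit, so `Summit.BirchSwinnertonDyer.BirchSwinnertonDyer.…` repeats a namespace BY DESIGN.
set_option linter.dupNamespace false

noncomputable section

open scoped Classical NumberField Pointwise

namespace Summit.BirchSwinnertonDyer.BirchSwinnertonDyer.Theorems.ShimuraWalk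

open WeierstrassCurve IsDedekindDomain NumberField Field Function Literature.NumberTheory.EllipticCurves
  Literature.NumberTheory.EllipticCurves.ModularForms Literature.NumberTheory.EllipticCurves.Jetchev2008
  Literature.NumberTheory.EllipticCurves.KolyvaginCocycle
  Literature.NumberTheory.EllipticCurves.Rank1Residual Literature.NumberTheory.GaloisRepresentations
  Literature.NumberTheory.GaloisCohomology Literature.NumberTheory.Automorphic
  Summit.BirchSwinnertonDyer.Rank1Residual.JET Summit.BirchSwinnertonDyer.Rank1Residual.JET.SelmerVocabulary
  Summit.BirchSwinnertonDyer.Rank1Residual.JET.Walk Summit.BirchSwinnertonDyer.Rank1Residual.JET.GlobalDuality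
  Summit.BirchSwinnertonDyer.Rank1Residual.X11b Summit.BirchSwinnertonDyer.Rank1Residual.X11b.Three
  Summit.BirchSwinnertonDyer.BirchSwinnertonDyer.Theorems
  Summit.BirchSwinnertonDyer.BirchSwinnertonDyer.Theorems.GenusLine

/-- **Kolyvagin's prime swap (McCallum Prop. 5.2) for the genus labelled family** — see the module docstring.
[cite: McCallumLMS1991, §5 Prop. 5.2] [cite: GrossLMS1991, §3 (3.2), Prop. 5.4, Prop. 6.2 (1)] -/
theorem genusSwapSupplyAt_of_frameProfile
    (hG1 : ∀ (N : ℕ) [NeZero N] (W : WeierstrassCurve ℚ) (K : Type) [Field K] [NumberField K],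
      phi_heegnerPointOfConductor_mem_range_map_ringClassField_birch N W K)
    {W A : WeierstrassCurve ℚ} [W.IsElliptic] [W.IsGloballyMinimal] [A.IsElliptic] [A.IsGloballyMinimal]
    {p q : ℕ} [Fact p.Prime] [Fact q.Prime] {K : Type} [Field K] [NumberField K] [NeZero (W.conductorNorm ℤ)]
    (S : GenusHeegnerSettingRC W A p q K) (hprof : FrameProfile W A p q K)
    (DtW : ModularParametrizationData W (W.conductorNorm ℤ))
    {yK : (W.baseChange K).toAffine.Point}
    {ys : (m : ℕ) → (W.baseChange (ringClassField K S.ιc m)).toAffine.Point} {ε₀ : ℤ}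
    (hL : LabelsAt W (2 * W.conductorNorm ℤ) K S.ιc yK ys ε₀)
    (hid : haveI := S.nz; haveI := S.nf; ∀ (c : ℕ), c ≠ 0 → c.Coprime (S.E'.conductorNorm ℤ) →
      ∀ δ : GenusKolyvaginDatum S.E' K S.ιc S.Dt S.β S.d₁ c,
        genusTransport W S.E' S.D S.C₂ S.hWd K S.ιc δ = ys c ∨ genusTransport W S.E' S.D S.C₂ S.hWd K S.ιc δ = -ys c) :
    SwapSupplyAt hprof.quad S.ιc W (W.conductorNorm ℤ) p ys := by
  have hK : IsImaginaryQuadratic K := hprof.quad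
  have hp : p.Prime := Fact.out
  have hp2 : p ≠ 2 := p_ne_two_of_frameProfile hprof
  have hD : NumberField.discr K < -4 := GenusKolyvaginRC.discr_lt_neg_four_of_genus hK S.hd₁ S.hd₂ S.hd
  have hD3 : NumberField.discr K ≠ -3 := by omega
  have hD4 : NumberField.discr K ≠ -4 := by omega
  haveI : ∀ j : ℕ, NumberField (ringClassField K S.ιc j) := numberField_ringClassField K hK S.ιc
  have hPT : ∀ (K : Type) [Field K] [NumberField K], poitouTate_selmerStructure_duality_conj K :=
    fun K _ _ ↦ InputsPoitouTateSelmer.poitouTate_selmerStructure_duality_conj_holds K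
  -- hbot, hceb
  have hbot := torsionBy_eq_bot_of_frameProfile (W := W) (A := A) (p := p) (q := q) (K := K) hprof
  have hceb := Koly.hceb_family_of_surj (W := W) (N := W.conductorNorm ℤ) hK hp2 hprof.surj
  -- the per-datum producers in cell CR3's shapes
  have hA : ∀ (n : ℕ) (d : KolyvaginFamilyData W K S.ιc n), d.y = ys n → Squarefree n →
      (∀ q' ∈ n.primeFactors, IsKolyvaginPrime (W.conductorNorm ℤ) W K p q') →
      ∀ j : ℕ, IsAdmissible (absoluteGaloisGroup K) d.pointsSubgroup ((p ^ j : ℕ) : ℤ) :=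
    fun n d _ hn _ j ↦ isAdmissible_datum_of_frameProfile S hprof hn.ne_zero d j
  have hP : ∀ (n : ℕ) (d : KolyvaginFamilyData W K S.ιc n), d.y = ys n → Squarefree n →
      (∀ q' ∈ n.primeFactors, IsKolyvaginPrime (W.conductorNorm ℤ) W K p q') →
      ∀ j : ℕ, 1 ≤ j → (j : ℕ∞) ≤ frobLevelIndex W K p n →
        d.toGeomPoints d.derivedPoint ∈ invPoints (absoluteGaloisGroup K) d.pointsSubgroup ((p ^ j : ℕ) : ℤ) :=
    fun n d hdy hn hKP j hj hjM ↦ invPoints_datum_of_frameProfile S hprof DtW hL hj hn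
      (fun q' hq' ↦ ⟨hKP q' hq', (natCast_le_frobLevelIndex_iff hKP j).mp hjM q' hq'⟩) d hdy
  have hSel : ∀ (M n : ℕ) (d : KolyvaginFamilyData W K S.ιc n), 1 ≤ M → d.y = ys n → Squarefree n →
      (∀ q' ∈ n.primeFactors, IsKolyvaginPrime (W.conductorNorm ℤ) W K p q' ∧ FrobEqFrobInfty W K (p ^ M) q') →
      ∀ 𝔳 : HeightOneSpectrum (𝓞 K), (n : 𝓞 K) ∉ 𝔳.asIdeal →
        d.kolyvaginClass (Fact.out : p.Prime) M ∈ selmerLocalKer (W.baseChange K) (𝔳.adicCompletion K) ((p ^ M : ℕ) : ℤ) :=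
    fun M n d hM hdy hn hKol 𝔳 h𝔳 ↦ selmerLocalKer_datum_of_frameProfile hG1 S hprof DtW hL hid hM hn hKol d hdy 𝔳 h𝔳
  have hidx : ∀ {n : ℕ} (j : ℕ), (∀ q' ∈ n.primeFactors, IsKolyvaginPrime (W.conductorNorm ℤ) W K p q' ∧
      FrobEqFrobInfty W K (p ^ j) q') → ((j : ℕ) : ℕ∞) ≤ frobLevelIndex W K p n :=
    fun j hKol ↦ (natCast_le_frobLevelIndex_iff (fun q' hq' ↦ (hKol q' hq').1) j).mpr fun q' hq' ↦ (hKol q' hq').2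
  refine Swap.shimuraWalk_swapSupplyAt_of_family W hPT hK hD3 hD4 p hp2 S.ιc DtW ys hbot ?_ hceb ?_ ?_ hL.1 ?_ ?_ ?_
  · -- `hB4` read off (B4) of `LabelsAt` at the guard `2N_W`
    intro k hk hKP ℓ hℓ σ hσ
    have hle : ringClassField K S.ιc (k / ℓ) ≤ ringClassField K S.ιc k :=
      ringClassField_mono hK S.ιc (Nat.div_dvd_of_dvd (Nat.dvd_of_mem_primeFactors hℓ)) hk.ne_zero
    exact ⟨_, hL.2.2.2.2.1 k hk (guard_two_mul_level_of_frameProfile_gross hprof hKP) ℓ hℓ hle σ hσ⟩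
  · -- `hA`
    intro u m dm hdy hm hKol
    exact hA m dm hdy hm (fun q' hq' ↦ (hKol q' hq').1) (1 + u)
  · -- `hP`
    intro u m dm hdy hm hKol
    have hKol' : ∀ q' ∈ m.primeFactors, IsKolyvaginPrime (W.conductorNorm ℤ) W K p q' ∧ FrobEqFrobInfty W K (p ^ (1 + u)) q' :=
      fun q' hq' ↦ ⟨(hKol q' hq').1, by rw [Nat.add_comm]; exact (hKol q' hq').2⟩
    exact hP m dm hdy hm (fun q' hq' ↦ (hKol q' hq').1) (1 + u) (Nat.le_add_right 1 u) (hidx (1 + u) hKol')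
  · -- `hsign` (class form, per datum)
    intro τ hτ u m dm hdy hm hKol
    have hKol' : ∀ q' ∈ m.primeFactors, IsKolyvaginPrime (W.conductorNorm ℤ) W K p q' ∧ FrobEqFrobInfty W K (p ^ (1 + u)) q' :=
      fun q' hq' ↦ ⟨(hKol q' hq').1, by rw [Nat.add_comm]; exact (hKol q' hq').2⟩
    exact sign_datum_of_frameProfile S hprof DtW hL hτ (Nat.le_add_right 1 u) hm hKol' dm hdy
  · -- `hsel`: the root classes lie in `H_{𝓕(m)}` for the global intrinsic transverse family
    intro 𝒯 h𝒯 u m dm hdy hm hKol Q hA1 hQ hQP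
    have hKP : ∀ q' ∈ m.primeFactors, IsKolyvaginPrime (W.conductorNorm ℤ) W K p q' := fun q' hq' ↦ (hKol q' hq').1
    have huk : ((u + 1 : ℕ) : ℕ∞) ≤ frobLevelIndex W K p m := hidx (u + 1) hKol
    refine (mem_selmerGroup_selmerF_iff W _ 𝒯 hm.ne_zero _).mpr ⟨?_, ?_⟩
    · exact Koly.familyRootKummer_of_selmerLocalKer W hK S.ιc p ys hA hP hSel 1 m dm le_rfl hdy hm
        (fun q' hq' ↦ ⟨hKP q' hq', (hKol q' hq').2.of_dvd (pow_dvd_pow p (Nat.le_add_left 1 u))⟩) u Q hA1 hQ hQP huk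
    · exact (globalTransverse_mem_iff h𝒯 hm _).mpr fun ℓ hℓ ↦
        rootClass_familyData_mem_transverseKer W hK hD hp2 S.ιc 1 hm hKP dm u Q hA1 hQ hQP huk hℓ
  · -- `h44`: McCallum Prop. 4.4 for any two presentations, at the label guard `2N_W`
    intro u m l hml hl hlm hKol dm dml hdy hdly v hv
    have hm : Squarefree m := hml.squarefree_of_dvd (dvd_mul_right m l)
    have hKol' : ∀ q' ∈ (m * l).primeFactors, IsKolyvaginPrime (W.conductorNorm ℤ) W K p q' ∧
        FrobEqFrobInfty W K (p ^ (1 + u)) q' :=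
      fun q' hq' ↦ ⟨(hKol q' hq').1, by rw [Nat.add_comm]; exact (hKol q' hq').2⟩
    exact addOrderOf_localization_kolyvaginClass_familyData_eq_of_labelsGuard_of_admissible hK hD S.ιc rfl hp2 DtW ys hL hA
      (1 + u) m (m * l) dm dml l (Nat.le_add_right 1 u) hdy hdly hm hKol' hl hlm rfl
      (fun q' hq' ↦ (guard_two_mul_level_of_frameProfile_gross hprof (fun r hr ↦ (hKol r hr).1) q' hq').1) v hv

end Summit.BirchSwinnertonDyer.BirchSwinnertonDyer.Theorems.ShimuraWalk

end
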